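import Summits.AtomisticToContinuum.HydrodynamicLimit.Theorems.CollisionIsometryCLTDiffuseBackwardInfluenceSupersatDefs
import Literature.MathematicalPhysics.KineticTheory.GoodConfigurations
import HarnessLib

/-!
# The fixed-time pair-correlation lower bound (sub-goal (B) of `stub_stickLD`)
(crux `DiffuseBackwardInfluence`, stmt-AtomisticToContinuum-12950, line `share-nondegeneracy-one-flight`;
registered sub-goal `fixedTime_bound_reg`)

For a probability measure `μ₁ = oneStickLaw θ` on the sticks `𝕋³ × ℝ³`, a measurable set `S` of sticks, a
time `r` and a thickness `0 < ε < 1`, the pair-correlation of `S` at minimal-image distance `< ε` of the straight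
positions `posAt r z = x + r v (mod 1)` is bounded below by the square of the mass:
`vol(B_{ε/2}) · μ₁(S)² ≤ (μ₁ ⊗ μ₁)(S × S ∩ {dist_r < ε})`.

Proof (two-ball witness + Cauchy–Schwarz on the unit-volume torus): with
`F y := μ₁ {z ∈ S | d(y, posAt r z) < ε/2}` one has `∫ F dy = vol(B_{ε/2}) μ₁(S)` (Tonelli and translation
invariance of Haar measure, `Torus.volume_euclidDist_lt`),
`∫ F² dy ≤ vol(B_{ε/2}) · (μ₁ ⊗ μ₁)(S × S ∩ {dist_r < ε})` (Tonelli; two sticks both within `ε/2` of `y` are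
within `ε` of each other by the triangle inequality `torus_euclidDist_triangle`), and `(∫ F)² ≤ ∫ F²` since
`vol(𝕋³) = 1` (Hölder).
-/

namespace Summit.AtomisticToContinuum.HydrodynamicLimit.Theorems.DiffuseBackwardInfluenceShare

open scoped BigOperators Topology ENNReal Classical
open Filter Set MeasureTheory
open Literature.Analysis.FluidPDE
open Summit.AtomisticToContinuum.HydrodynamicLimit.Theorems.DiffuseBackwardInfluenceNeg

noncomputable section

namespace FewIdle

namespace Supersat

/-- The straight position is continuous in the stick. [folklore] -/
theorem continuous_posAt (r : ℝ) : Continuous (posAt r) := by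
  have hp : Continuous (Literature.Analysis.FunctionSpaces.Torus.proj : V3 → T3) :=
    Literature.Analysis.FunctionSpaces.Torus.continuous_proj
  change Continuous fun z : T3 × V3 => z.1 + Literature.Analysis.FunctionSpaces.Torus.proj (r • z.2)
  fun_prop

/-- The straight position is measurable in the stick. [folklore] -/
theorem measurable_posAt (r : ℝ) : Measurable (posAt r) :=
  (continuous_posAt r).measurable

/-- Joint measurability of the minimal-image distance from a point to a straight position. [folklore] -/
theorem measurable_euclidDist_posAt (r : ℝ) :
    Measurable fun p : T3 × (T3 × V3) => Torus.euclidDist p.1 (posAt r p.2) := by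
  have h1 : Measurable fun p : T3 × (T3 × V3) => (p.1, posAt r p.2) :=
    measurable_fst.prodMk ((measurable_posAt r).comp measurable_snd)
  have h2 := (Torus.continuous_euclidDist (d := Fin 3)).measurable.comp h1
  simpa only [Function.comp_def] using h2

/-- Measurability of the pair distance set `{(z, z') | d(posAt r z, posAt r z') < ε}`. [folklore] -/
theorem measurableSet_pairNear (r ε : ℝ) :
    MeasurableSet {q : (T3 × V3) × (T3 × V3) | Torus.euclidDist (posAt r q.1) (posAt r q.2) < ε} := by
  have h1 : Measurable fun q : (T3 × V3) × (T3 × V3) => (posAt r q.1, posAt r q.2) :=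
    ((measurable_posAt r).comp measurable_fst).prodMk ((measurable_posAt r).comp measurable_snd)
  have h2 : Measurable fun q : (T3 × V3) × (T3 × V3) => Torus.euclidDist (posAt r q.1) (posAt r q.2) := by
    simpa only [Function.comp_def] using (Torus.continuous_euclidDist (d := Fin 3)).measurable.comp h1
  exact measurableSet_lt h2 measurable_const

/-- Measurability of the witness set `{(y, z) | z ∈ S, d(y, posAt r z) < δ}`. [folklore] -/
theorem measurableSet_near {S : Set (T3 × V3)} (hS : MeasurableSet S) (r δ : ℝ) :
    MeasurableSet {p : T3 × (T3 × V3) | p.2 ∈ S ∧ Torus.euclidDist p.1 (posAt r p.2) < δ} :=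
  (measurable_snd hS).inter (measurableSet_lt (measurable_euclidDist_posAt r) measurable_const)

/-- **First moment of the witness function**: `∫ μ{z ∈ S | d(y, posAt r z) < δ} dy = vol(B_δ) μ(S)` for
`δ < 1/2` (Tonelli, and every minimal-image ball of radius `δ < 1/2` has the Euclidean volume). [folklore] -/
theorem lintegral_near_eq (μ : Measure (T3 × V3)) [SFinite μ] {S : Set (T3 × V3)} (hS : MeasurableSet S)
    (r : ℝ) {δ : ℝ} (hδ : δ < 1 / 2) :
    ∫⁻ y, μ (Prod.mk y ⁻¹' {p : T3 × (T3 × V3) | p.2 ∈ S ∧ Torus.euclidDist p.1 (posAt r p.2) < δ}) =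
      volume (Metric.ball (0 : V3) δ) * μ S := by
  rw [← Measure.prod_apply (measurableSet_near hS r δ), Measure.prod_apply_symm (measurableSet_near hS r δ)]
  have key : ∀ z : T3 × V3, volume ((fun y : T3 => (y, z)) ⁻¹'
      {p : T3 × (T3 × V3) | p.2 ∈ S ∧ Torus.euclidDist p.1 (posAt r p.2) < δ}) =
        S.indicator (fun _ => volume (Metric.ball (0 : V3) δ)) z := by
    intro z
    by_cases hz : z ∈ S
    · rw [indicator_of_mem hz, ← Torus.volume_euclidDist_lt hδ (posAt r z)]
      congr 1
      ext y
      simp only [mem_preimage, mem_setOf_eq, and_iff_right hz]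
    · rw [indicator_of_notMem hz]
      have h0 : ((fun y : T3 => (y, z)) ⁻¹'
          {p : T3 × (T3 × V3) | p.2 ∈ S ∧ Torus.euclidDist p.1 (posAt r p.2) < δ}) = ∅ :=
        eq_empty_of_forall_notMem fun y hy => hz hy.1
      rw [h0, measure_empty]
  simp_rw [key]
  rw [lintegral_indicator_const hS]

/-- **Second moment of the witness function**: `∫ μ{z ∈ S | d(y, posAt r z) < ε/2}² dy ≤
vol(B_{ε/2}) · (μ ⊗ μ)(S × S ∩ {dist_r < ε})` — two `S`-sticks both within `ε/2` of `y` are within `ε` of each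
other (triangle inequality for the minimal-image distance), and the set of such `y` has volume `≤ vol(B_{ε/2})`.
[folklore] -/
theorem lintegral_near_sq_le (μ : Measure (T3 × V3)) [SFinite μ] {S : Set (T3 × V3)} (hS : MeasurableSet S)
    (r : ℝ) {ε : ℝ} (hε1 : ε < 1) :
    ∫⁻ y, μ (Prod.mk y ⁻¹'
        {p : T3 × (T3 × V3) | p.2 ∈ S ∧ Torus.euclidDist p.1 (posAt r p.2) < ε / 2}) ^ 2 ≤
      volume (Metric.ball (0 : V3) (ε / 2)) *
        ∫⁻ q, (S ×ˢ S ∩ {q : (T3 × V3) × (T3 × V3) |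
          Torus.euclidDist (posAt r q.1) (posAt r q.2) < ε}).indicator 1 q ∂(μ.prod μ) := by
  have hAm := measurableSet_near hS r (ε / 2)
  set A : Set (T3 × (T3 × V3)) := {p | p.2 ∈ S ∧ Torus.euclidDist p.1 (posAt r p.2) < ε / 2} with hA
  have hBm : MeasurableSet {p : T3 × ((T3 × V3) × (T3 × V3)) | (p.1, p.2.1) ∈ A ∧ (p.1, p.2.2) ∈ A} :=
    ((measurable_fst.prodMk (measurable_fst.comp measurable_snd)) hAm).inter
      ((measurable_fst.prodMk (measurable_snd.comp measurable_snd)) hAm)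
  have hsq : ∀ y : T3, μ (Prod.mk y ⁻¹' A) ^ 2 = (μ.prod μ) (Prod.mk y ⁻¹'
      {p : T3 × ((T3 × V3) × (T3 × V3)) | (p.1, p.2.1) ∈ A ∧ (p.1, p.2.2) ∈ A}) := by
    intro y
    rw [sq, ← Measure.prod_prod]
    rfl
  simp_rw [hsq]
  rw [← Measure.prod_apply hBm, Measure.prod_apply_symm hBm,
    ← lintegral_const_mul' _ _ measure_ball_lt_top.ne]
  refine lintegral_mono fun q => ?_
  by_cases hq : q ∈ S ×ˢ S ∩ {q : (T3 × V3) × (T3 × V3) | Torus.euclidDist (posAt r q.1) (posAt r q.2) < ε}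
  · rw [indicator_of_mem hq, Pi.one_apply, mul_one]
    calc volume ((fun y : T3 => (y, q)) ⁻¹'
          {p : T3 × ((T3 × V3) × (T3 × V3)) | (p.1, p.2.1) ∈ A ∧ (p.1, p.2.2) ∈ A})
        ≤ volume {y : T3 | Torus.euclidDist y (posAt r q.1) < ε / 2} := measure_mono fun y hy => hy.1.2
      _ = volume (Metric.ball (0 : V3) (ε / 2)) := Torus.volume_euclidDist_lt (by linarith) _
  · rw [indicator_of_notMem hq, mul_zero]
    have h0 : ((fun y : T3 => (y, q)) ⁻¹'
        {p : T3 × ((T3 × V3) × (T3 × V3)) | (p.1, p.2.1) ∈ A ∧ (p.1, p.2.2) ∈ A}) = ∅ := by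
      refine eq_empty_of_forall_notMem fun y hy => hq ⟨⟨hy.1.1, hy.2.1⟩, ?_⟩
      calc Torus.euclidDist (posAt r q.1) (posAt r q.2)
          ≤ Torus.euclidDist (posAt r q.1) y + Torus.euclidDist y (posAt r q.2) :=
            Literature.MathematicalPhysics.KineticTheory.torus_euclidDist_triangle _ _ _
        _ < ε / 2 + ε / 2 := add_lt_add (by rw [Torus.euclidDist_comm]; exact hy.1.2) hy.2.2
        _ = ε := by ring
    rw [h0, measure_empty]

/-- **Cauchy–Schwarz on the unit-volume torus**: `(∫ F)² ≤ ∫ F²` for measurable `F : 𝕋³ → [0, ∞]`.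
[folklore] -/
theorem sq_lintegral_le {F : T3 → ℝ≥0∞} (hF : Measurable F) : (∫⁻ y, F y) ^ 2 ≤ ∫⁻ y, F y ^ 2 := by
  haveI := isProbabilityMeasure_volume_T3
  have h := ENNReal.lintegral_mul_le_Lp_mul_Lq (volume : Measure T3) Real.HolderConjugate.two_two
    hF.aemeasurable (g := fun _ => (1 : ℝ≥0∞)) aemeasurable_const
  simp only [Pi.mul_apply, mul_one, ENNReal.rpow_two, one_pow, lintegral_const, measure_univ,
    ENNReal.one_rpow] at h
  calc (∫⁻ y, F y) ^ 2 ≤ ((∫⁻ y, F y ^ 2) ^ (1 / 2 : ℝ)) ^ 2 := by gcongr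
    _ = ∫⁻ y, F y ^ 2 := by
      rw [← ENNReal.rpow_two, ← ENNReal.rpow_mul]
      norm_num

end Supersat

end FewIdle

/-- **REGISTERED SUB-GOAL (B) of `stub_stickLD` — the fixed-time pair-correlation lower bound.** For the one-stick
law `μ₁ = oneStickLaw θ` (only "probability measure" is used), a measurable set `S` of sticks, a time `r` and a
thickness `0 < ε < 1`: `vol(B_{ε/2}) · μ₁(S)² ≤ (μ₁ ⊗ μ₁)(S × S ∩ {(z, z') | d(posAt r z, posAt r z') < ε})`, the
right-hand side written as the integral of the indicator. Two-ball witness `F y = μ₁{z ∈ S | d(y, posAt r z) < ε/2}`: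
`(vol(B_{ε/2}) μ₁(S))² = (∫ F)² ≤ ∫ F² ≤ vol(B_{ε/2}) · RHS` (`lintegral_near_eq`, `sq_lintegral_le`,
`lintegral_near_sq_le`), then cancel one factor `vol(B_{ε/2}) ∈ (0, ∞)`. [folklore] -/
theorem fixedTime_bound_reg : ∀ (θ : ℝ) [IsProbabilityMeasure (FewIdle.oneStickLaw θ)] (S : Set (T3 × V3)), MeasurableSet S → ∀ (r ε : ℝ), 0 < ε → ε < 1 → volume (Metric.ball (0 : V3) (ε / 2)) * (FewIdle.oneStickLaw θ S) ^ 2 ≤ ∫⁻ q, (S ×ˢ S ∩ {q : (T3 × V3) × (T3 × V3) | Torus.euclidDist (FewIdle.Supersat.posAt r q.1) (FewIdle.Supersat.posAt r q.2) < ε}).indicator 1 q ∂((FewIdle.oneStickLaw θ).prod (FewIdle.oneStickLaw θ)) := by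
  intro θ _ S hS r ε hε hε1
  have hδ : ε / 2 < 1 / 2 := by linarith
  have h1 := FewIdle.Supersat.lintegral_near_eq (FewIdle.oneStickLaw θ) hS r hδ
  have h2 := FewIdle.Supersat.lintegral_near_sq_le (FewIdle.oneStickLaw θ) hS r hε1
  have h3 := FewIdle.Supersat.sq_lintegral_le (measurable_measure_prodMk_left (ν := FewIdle.oneStickLaw θ)
    (FewIdle.Supersat.measurableSet_near hS r (ε / 2)))
  rw [h1] at h3
  have key := h3.trans h2
  rw [mul_pow, sq (volume (Metric.ball (0 : V3) (ε / 2))), mul_assoc] at key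
  exact (ENNReal.mul_le_mul_iff_right (Metric.measure_ball_pos volume (0 : V3) (by linarith)).ne'
    measure_ball_lt_top.ne).1 key

end

end Summit.AtomisticToContinuum.HydrodynamicLimit.Theorems.DiffuseBackwardInfluenceShare
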